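import Summits.BirchSwinnertonDyer.Rank1Residual.X2.TamagawaSqueeze
import Summits.BirchSwinnertonDyer.Rank1Residual.X1.CongruenceTransfer
import HarnessLib

/-!
# Class X2 (odd multiplicative Eisenstein prime): ROUTE G at `p ‖ N` — the GREENBERG–VATSAL
# CONGRUENCE TRANSFER of the algebraic Iwasawa invariants: `E₀[p] ≅ E₀'[p]`, both `μ = 0`, the
# invariants of `E₀'` KNOWN (a closed pair of X1 or X2) ⇒ `(μ_alg, λ_alg)(E₀)` KNOWN ⇒ Mazur's
# main conjecture at `(E₀, p)` iff `λ_an(E₀) = λ_alg(E₀) + e` (cell `b2b-bsdres`, unit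
# `b2b-bsdres-eisenstein-p2`, gen 7)

HONEST FRAMING (run/shared/lean/b2b/bsd-rank1-residual/, verbatim in every file): the goal of the
cell is to DELETE the COMBINATION-SHAPED residual classes of the Birch–Swinnerton-Dyer formula for
ALL analytic-rank `≤ 1` elliptic curves over `ℚ` — "full BSD formula for every rank `≤ 1` curve in
class `C`" assembled STRICTLY from published theorems — so that the rank-`≤ 1` remainder becomes
exactly the CONSTRUCTION-SHAPED classes, which are TYPED (missing-input `Prop`s), NOT attempted.
This is not "finishing BSD". Research routes; NO CLAIM BEYOND STATED CLASSES; nothing here changes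
a label; X2b and X2c stay CONSTRUCTION-SHAPED. ONE typed def (`AlgebraicInvariantsEq`, the per-pair
statement "`(μ_alg, λ_alg)(E,p) = (0, k)`", nothing asserted); everything else is a theorem over the
tree's existing PUBLISHED named facts (Wuthrich 2014 Thm. 16, modularity), taken as hypotheses, the
cell's TYPED analytic inputs (`X2.AnalyticMuLE`, `X2.AnalyticLambdaEq`; `X1.MuPart.AnalyticMuLE`,
`X1.ParitySqueeze.AnalyticLambdaEq`) and sub-cell `eisenstein-p1`'s TYPED transfer statement
`X1.CongruenceTransfer.CongruentLambdaShift W W' p e` / `TorsionIso W W' p` (p210139, gen 7 of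
`X1/CongruenceTransfer.lean`), consumed VERBATIM (they carry no reduction hypothesis).

WHY THIS FILE. Routes lamMin / P / T (gens 4–6: `X2/LambdaMinimal.lean`, `X2/ParitySqueeze.lean`,
`X2/TamagawaSqueeze.lean`) bound `λ_alg(E,p) = λ(X(E/ℚ_∞))` at a multiplicative Eisenstein prime from
below by invariants of `E` itself. Greenberg–Vatsal, Invent. Math. 142 (2000) §2, show that — up to
EXPLICIT local terms — `λ` is an invariant of the residual representation, and their §2 is written
for "the case where `E` has multiplicative reduction at `p`" as well (p. 14–15: "If `E` has nonsplit
multiplicative reduction at `p`, then the arguments … go through almost unchanged. However, if `E`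
has split multiplicative [reduction] at `p`, then there is an interesting difference: `Sel_E(ℚ_∞)_p`
coincides with the 'strict' Selmer group … But `S_{E[p^∞]}(ℚ_∞)` is actually bigger. This corresponds
to the fact that the associated `p`-adic `L`-function has a trivial zero. It is only when the trivial
zero is included that our approach proceeds smoothly"; Remark (2.10): "weight 2 eigenforms whose
levels are not divisible by `p²` and which are ordinary at `p`"). Concretely (pp. 20–27): with
`A = E[p^∞]`, `C = F⁺A` the `I_p`-line of cyclotomic character (`μ_{p^∞}(δ)` for the Tate curve,
`δ` unramified quadratic, trivial iff split), `D = A/C` (on which `I_p` acts trivially — the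
hypothesis of Prop. (2.8)), Greenberg's `S_A(ℚ_∞) ⊇ Sel_E(ℚ_∞)_p` with `S_A/Sel_E ≅ D/(Frob−1)D`, i.e.
`λ(S_A) = λ(X(E/ℚ_∞)) + e_p(E)` (`e_p = 1` at a split prime, `0` at a non-split or good prime —
HOME/b2b-bsdres-eisenstein-p2/X2-GAP.md §2.1 Step 3); Cor. (2.3) + Prop. (2.4):
`λ(S^{Σ₀}_A) = λ(S_A) + Σ_{ℓ∈Σ₀} s_ℓ d_ℓ(E)`; Prop. (2.8): `S^{Σ₀}_A[p] = S^{Σ₀}_{A[p]}(ℚ_∞)` depends on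
the `G_ℚ`-module `E[p]` alone (`C[p]` is the unique `ω`-line of `E[p]|_{I_p}` at odd `p`; plus the
remark `dim S^{Σ₀}_{A[p]} = λ^{Σ₀} + dim E(ℚ_∞)[p]` of X1R0-GAPMAP §16.0 when `E(ℚ)[p] ≠ 0`). Hence
for two curves `E₀, E₀'`, each good ordinary OR multiplicative at the odd prime `p`, with
`E₀[p] ≅ E₀'[p]` and `μ(E₀) = μ(E₀') = 0`:

  `λ(X(E₀/ℚ_∞)) = λ(X(E₀'/ℚ_∞)) + e`, `e = [e_p(E₀') − e_p(E₀)] + Σ_{ℓ ∣ N N', ℓ ≠ p} s_ℓ·(d_ℓ(E₀') − d_ℓ(E₀))`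

(`s_ℓ = p^{ord_p(ℓ^{p−1}−1)−1}`, `d_ℓ` = multiplicity of `ℓ^{-1}` as a root of `P_ℓ(X) mod p`: good
`ℓ`: `[φ(ℓ) = ω(ℓ)] + [φ(ℓ) = 1]`; split `ℓ`: `[ℓ ≡ 1]`; non-split `ℓ`: `[ℓ ≡ −1 (mod p)]`; additive
`ℓ`: `0`) — EXACTLY the typed statement `CongruentLambdaShift W W' p e` of sub-cell eisenstein-p1, whose
integer `e` now carries the trivial-zero term. In terms of the census quantity
`Λ := λ_alg + e_p` (which Mazur's main conjecture equates with `λ_an`, trivial zero INCLUDED, the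
cell's `X2.AnalyticLambdaEq`), the transfer reads `Λ(E₀) = Λ(E₀') + Σ s_ℓ(d_ℓ(E₀') − d_ℓ(E₀))` with
no term at `p` at all. The transfer lives OUTSIDE the kernel (the tree has no non-primitive Selmer
groups of `E[p]` over `ℚ_∞`); this file proves what the kernel does with it:

* `AlgebraicInvariantsEq W p k` (TYPED) — "`X(E/ℚ_∞)` is torsion, `μ(X) = 0`, `λ(X) = k`" for the
  cyclotomic data — the OUTPUT certificate of every main-conjecture route and the currency of route G.
* SUPPLIERS at a closed pair: `algebraicInvariantsEq_of_mazurMainConjectureAt` (X2 pair: Mazur's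
  MC at `(E',p)` + `μ_an = 0` + `λ_an = n'` ⇒ `(0, n' − e_p)`), `algebraicInvariantsEq_of_mazurMainConjecture`
  (X1 pair, good ordinary: ⇒ `(0, n')`, via eisenstein-p1's partner lemma).
* TARGET side: `isTorsion_and_mu_eq_zero_of_analyticMuLE_zero` (`μ_an(E₀) = 0 ⇒ μ(X) = 0` at a
  multiplicative Eisenstein prime, Kato–Wuthrich direction only); the TRANSFER
  `algebraicInvariantsEq_of_congruentLambdaShift` (X2 target) and `…_goodOrd` (X1 target, so that
  X1 classes may use X2 partners).
* ROUTE T WITH THE EXACT VALUE (`(μ_alg, λ_alg) = (0,k)`, `μ_an = 0`, `λ_an = n`, `n ≤ k + e_p` ⇒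
  `X2.MazurMainConjectureAt W p`; consistency `k + e_p ≤ n`) is in the companion file
  `X2/CongruenceTransferSqueeze.lean`; the cell forms (rank-`0` `BSD(E,p)`, X2b, X2c, the headline
  compositions with a closed X1 / X2 partner) in `X2/CongruenceTransferForms.lean`.

References: [GreenbergVatsal2000] §2: Props. (2.1), (2.4), (2.5), (2.8), Cor. (2.3), Remarks (2.9),
(2.10), pp. 14–15, 20–27 of arXiv:math/9906215; [GreenbergLNM1716] §3 (PDF p. 91), Prop. 3.6;
[Wuthrich2014] Thm. 16; HOME/b2b-bsdres-eisenstein-p2/X2-GAP.md §2.1, §12;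
HOME/b2b-bsdres-eisenstein-p1/X1R0-GAPMAP.md §16.
-/

set_option autoImplicit false

noncomputable section

open scoped Classical MatrixGroups ModularForm

open PowerSeries CongruenceSubgroup WeierstrassCurve Literature.NumberTheory.EllipticCurves
  Literature.NumberTheory.EllipticCurves.ModularForms
  Literature.NumberTheory.EllipticCurves.Rank1Residual
  Literature.NumberTheory.EllipticCurves.Rank1Residual.Typed
  Literature.NumberTheory.EllipticCurves.Wuthrich2014
  Literature.NumberTheory.EllipticCurves.Greenberg1999
  Summit.BirchSwinnertonDyer.BirchSwinnertonDyer.Theorems.Rank1ResidualX1Defs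
  Summit.BirchSwinnertonDyer.Rank1Residual.X1.MuLambda
  Summit.BirchSwinnertonDyer.Rank1Residual.X1.MuPart
  Summit.BirchSwinnertonDyer.Rank1Residual.X1.ParitySqueeze
  Summit.BirchSwinnertonDyer.Rank1Residual.X1.TamagawaSqueeze
  Summit.BirchSwinnertonDyer.Rank1Residual.X1.CongruenceTransfer

namespace Summit.BirchSwinnertonDyer.Rank1Residual.X2

/-! ## §1. "`(μ_alg, λ_alg)(E, p) = (0, k)`", TYPED (nothing asserted) -/

/-- **"The algebraic Iwasawa invariants of `E` at `p` are `(μ, λ) = (0, k)`" (TYPED; nothing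
asserted).** For the cyclotomic `ℤ_p`-extension `κ`, every topological generator `γ` matching the
cyclotomic variable, and EVERY Pontryagin-dual datum `D` of `Sel_{p^∞}(E/ℚ_∞)`: `X = X(E/ℚ_∞)` is
`Λ`-torsion, `μ(X) = 0` and `λ(X) = k` — Greenberg–Vatsal's `μ^{alg}_E = 0`, `λ^{alg}_E = k`
(display (1)). It is the OUTPUT of every main-conjecture route of the cell at a `μ_an = 0` member
(`algebraicInvariantsEq_of_mazurMainConjectureAt`, `…_of_mazurMainConjecture`) and the currency of
the congruence transfer (`algebraicInvariantsEq_of_congruentLambdaShift`). No reduction hypothesis.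
[cite: GreenbergVatsal2000, p. 2, (1)–(2) (shape only; nothing asserted)] -/
def AlgebraicInvariantsEq (W : WeierstrassCurve ℚ) [W.IsElliptic] [W.IsGloballyMinimal] (p : ℕ)
    [Fact p.Prime] (k : ℕ) : Prop :=
  ∀ (κ : ZpExtension ℚ p) (γ : Field.absoluteGaloisGroup ℚ),
      κ.IsCyclotomic → κ.IsTopGenerator γ → IsCyclotomicVariable p γ →
    ∀ (D : W.SelmerDualData κ γ), D.IsTorsion ∧ D.mu = 0 ∧ lambdaInvariant p D.X = k

/-! ## §2. Algebra: reading `(μ, λ)` of a generator off `ι(u·g·w) = ϖ·L` -/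

section Algebra

variable {p : ℕ} [Fact p.Prime]

/-- If `u·g·w ≠ 0` has `μ(u·g·w) = 0` and `λ(u·g·w) = n`, with `λ(u) = e` and `w` a unit, then
`μ(g) = 0` and `λ(g) + e = n` (`μ`, `λ` additive; units have `μ = λ = 0`). [cite: Washington1997, §7.1] -/
theorem mu_eq_zero_and_lam_add_eq_of_mul_mul_unit {u g : IwasawaAlgebra p} {w : (IwasawaAlgebra p)ˣ}
    {e n : ℕ} (h0 : u * g * (w : IwasawaAlgebra p) ≠ 0) (hlu : lam u = e)
    (hμ : mu (u * g * (w : IwasawaAlgebra p)) = 0) (hl : lam (u * g * (w : IwasawaAlgebra p)) = n) :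
    mu g = 0 ∧ lam g + e = n := by
  have hw0 : (w : IwasawaAlgebra p) ≠ 0 := w.ne_zero
  have hug : u * g ≠ 0 := fun h ↦ h0 (by rw [h, zero_mul])
  have hu : u ≠ 0 := fun h ↦ hug (by rw [h, zero_mul])
  have hg : g ≠ 0 := fun h ↦ hug (by rw [h, mul_zero])
  obtain ⟨-, hμw, hlw⟩ := (isUnit_iff_mu_eq_zero_and_lam_eq_zero (w : IwasawaAlgebra p)).mp w.isUnit
  rw [mu_mul hug hw0, mu_mul hu hg, hμw] at hμ
  rw [lam_mul hug hw0, lam_mul hu hg, hlw, hlu] at hl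
  constructor <;> omega

end Algebra

/-! ## §3. SUPPLIERS: the invariants at a CLOSED pair -/

section Supplier

variable {W : WeierstrassCurve ℚ} [W.IsElliptic] [W.IsGloballyMinimal] {p : ℕ} [Fact p.Prime]

/-- **`(μ_alg, λ_alg) = (0, λ_an − e_p)` at a CLOSED X2 pair.** `W/ℚ` globally minimal elliptic
with multiplicative reduction at `p`; Mazur's main conjecture at `(E,p)` in the cell's shape
(`X2.MazurMainConjectureAt W p` — per pair: sub-cell X2a by Greenberg–Vatsal, routes lamMin / P / T,
or route G itself), `μ_an = 0` (`AnalyticMuLE W p 0`) and `λ_an = n` (`AnalyticLambdaEq W p n`,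
trivial zero INCLUDED); modularity (`hpar`) and the tree's existence theorems for THE multiplicative
`p`-adic `L`-function instantiate the data. Then `AlgebraicInvariantsEq W p k` for `k = n` at a
non-split prime and `k + 1 = n` at a split prime: `char X = (g)`, `ι(T^{e}·g·w) = ϖ·L`,
`μ(T^e g w) = 0`, `λ(T^e g w) = n`, so `μ(g) = 0 = μ(X)` and `λ(X) = λ(g) = n − e`.
[cite: GreenbergVatsal2000, p. 2–4, (1)–(2)] [cite: Washington1997, §13.2] -/
theorem algebraicInvariantsEq_of_mazurMainConjectureAt (hpar : nonempty_modularParametrizationData)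
    (W : WeierstrassCurve ℚ) [W.IsElliptic] [W.IsGloballyMinimal] (p : ℕ) [Fact p.Prime]
    (hmult : W.HasMultiplicativeReductionAtPrime p) (hMC : X2.MazurMainConjectureAt W p) {n k : ℕ}
    (hμ0 : AnalyticMuLE W p 0) (hlam : AnalyticLambdaEq W p n)
    (hkN : ¬ W.HasSplitMultiplicativeReductionAtPrime p → k = n)
    (hkS : W.HasSplitMultiplicativeReductionAtPrime p → k + 1 = n) :
    AlgebraicInvariantsEq W p k := by
  intro κ γ hκ hγ hγ' D
  haveI : NeZero (W.conductorNorm ℤ) := ⟨(W.conductorNorm_pos_holds).ne'⟩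
  haveI : Module.Finite (IwasawaAlgebra p) D.X := D.module_finite_holds hγ
  obtain ⟨Dm⟩ := hpar W
  have hf : IsNewformOf W Dm.f := Dm.isNewformOf
  obtain ⟨ϖ, -, hϖ, -⟩ := Dm.exists_rat_mul_realPeriodRat_eq_plusPeriod
  obtain ⟨hX, g, hchar, hS, hN⟩ := hMC κ γ hκ hγ hγ' Dm.f hf D ϖ hϖ
  -- reading the certificates at `G = u · g · w`, `λ(u) = e`
  have read : ∀ (u : IwasawaAlgebra p) (w : (IwasawaAlgebra p)ˣ) (e : ℕ) (L : PowerSeries ℚ_[p]),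
      lam u = e →
      (W.HasSplitMultiplicativeReductionAtPrime p → IsSplitMultPAdicLFunctionOf Dm.f p L) →
      (¬ W.HasSplitMultiplicativeReductionAtPrime p → IsMultPAdicLFunctionOf Dm.f p (-1) L) →
      iwasawaToPowerSeries p (u * g * (w : IwasawaAlgebra p)) = PowerSeries.C ((ϖ : ℚ) : ℚ_[p]) * L →
      D.IsTorsion ∧ D.mu = 0 ∧ lambdaInvariant p D.X + e = n := by
    intro u w e L hlu hLs hLn hι
    obtain ⟨k', hk'⟩ := hμ0 Dm.f hf ϖ hϖ L hLs hLn
    have hL0 : PowerSeries.C ((ϖ : ℚ) : ℚ_[p]) * L ≠ 0 := ne_zero_of_lt_norm_coeff hk'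
    have hG0 : u * g * (w : IwasawaAlgebra p) ≠ 0 := by
      intro h0; apply hL0; rw [← hι, h0, map_zero]
    have hg0 : g ≠ 0 := fun h0 ↦ hG0 (by rw [h0, mul_zero, zero_mul])
    rw [← hι] at hk'
    have hμG : mu (u * g * (w : IwasawaAlgebra p)) = 0 := Nat.le_zero.mp (mu_le_of_lt_norm_coeff hk')
    have hlG : lam (u * g * (w : IwasawaAlgebra p)) = n := hlam Dm.f hf ϖ hϖ L hLs hLn _ hι
    obtain ⟨hμg, hlg⟩ := mu_eq_zero_and_lam_add_eq_of_mul_mul_unit hG0 hlu hμG hlG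
    refine ⟨hX, ?_, ?_⟩
    · rw [SelmerDualData.mu, ← mu_generator_eq_muInvariant D.X hX hg0 hchar, hμg]
    · rw [← lam_generator_eq_lambdaInvariant D.X hX hg0 hchar]; exact hlg
  by_cases hsplit : W.HasSplitMultiplicativeReductionAtPrime p
  · obtain ⟨L, hL⟩ := exists_isSplitMultPAdicLFunctionOf hsplit hf
    obtain ⟨w, hι⟩ := hS hsplit L hL
    obtain ⟨hX', hμ', hl'⟩ := read PowerSeries.X w 1 L lam_X (fun _ ↦ hL)
      (fun hns ↦ absurd hsplit hns) hι
    have := hkS hsplit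
    exact ⟨hX', hμ', by omega⟩
  · obtain ⟨L, hL⟩ := exists_isMultPAdicLFunctionOf_neg_one_of_nonsplit hf hmult hsplit
    obtain ⟨w, hι⟩ := hN hsplit L hL
    obtain ⟨hX', hμ', hl'⟩ := read 1 w 0 L (lam_eq_zero_of_isUnit isUnit_one) (fun hs ↦ absurd hs hsplit)
      (fun _ ↦ hL) (by rw [one_mul]; exact hι)
    have := hkN hsplit
    exact ⟨hX', hμ', by omega⟩

/-- **`(μ_alg, λ_alg) = (0, λ_an)` at a CLOSED X1 pair** (good ordinary Eisenstein, `p ≠ 2`):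
Mazur's main conjecture at `(E,p)` (`MazurMainConjecture W p`; per pair: routes S/P/T/C/G at
`r = 0`, x1b's P1/P3 at `r = 1`), `μ_an = 0` (`X1.MuPart.AnalyticMuLE W p 0`) and `λ_an = n`
(`X1.ParitySqueeze.AnalyticLambdaEq W p n`); Wuthrich 2014 Thm. 16 (`hW16`) and modularity
(`hmod`) PUBLISHED. Sub-cell eisenstein-p1's partner lemma
`X1.CongruenceTransfer.isTorsion_and_lambdaInvariant_eq_of_mazurMainConjecture` gives torsion and
`λ(X) = n`; `X1.MuPart.mu_eq_zero_of_analyticMuLE_zero` gives `μ(X) = 0`.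
[cite: GreenbergVatsal2000, p. 2–4, (1)–(2)] [cite: Wuthrich2014, Thm. 16 (p. 397)] -/
theorem algebraicInvariantsEq_of_mazurMainConjecture
    (hW16 : Wuthrich2014.charIdeal_dvd_padicLFunction) (hmod : nonempty_modularParametrizationData)
    (W : WeierstrassCurve ℚ) [W.IsElliptic] [W.IsGloballyMinimal] (p : ℕ) [Fact p.Prime]
    (hp : p ≠ 2) (hgood : W.HasGoodReductionAtPrime p) (hord : ¬ (p : ℤ) ∣ W.frobeniusTrace p)
    (hred : ¬ W.HasIrreducibleModPGaloisRep p) (hMC : MazurMainConjecture W p) {n : ℕ}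
    (hμ0 : X1.MuPart.AnalyticMuLE W p 0) (hlam : X1.ParitySqueeze.AnalyticLambdaEq W p n) :
    AlgebraicInvariantsEq W p n := by
  intro κ γ hκ hγ hγ' D
  obtain ⟨hX, hl⟩ :=
    isTorsion_and_lambdaInvariant_eq_of_mazurMainConjecture hmod hgood hord hMC hlam hκ hγ hγ' D
  exact ⟨hX, mu_eq_zero_of_analyticMuLE_zero hW16 hmod hp hgood hord hred hμ0 hκ hγ hγ' D, hl⟩

end Supplier

/-! ## §4. TARGET side: `μ(X) = 0` from `μ_an = 0`, and the transfer -/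

section Target

variable {W W' : WeierstrassCurve ℚ} [W.IsElliptic] [W.IsGloballyMinimal]
  [W'.IsElliptic] [W'.IsGloballyMinimal] {p : ℕ} [Fact p.Prime]

/-- **`X(E/ℚ_∞)` is torsion and `μ(X) = 0` at a `μ_an = 0` member of an X2 class** (odd
multiplicative prime, `E[p]` reducible): Wuthrich 2014 Thm. 16 (`hWu`: `X` torsion and
`ϖ·L = ι(T^e·g)` with `g ∈ char_Λ X = (f_E)`) + the certificate `AnalyticMuLE W p 0` give
`μ(f_E) ≤ μ(T^e·g) = μ(ϖ·L) = 0` — Kato's direction alone, no main conjecture; modularity (`hpar`) and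
the tree's existence theorems for THE multiplicative `p`-adic `L`-function instantiate the data.
The multiplicative twin of `X1.MuPart.mu_eq_zero_of_analyticMuLE_zero`.
[cite: Wuthrich2014, Thm. 16 and §5 (p. 397)] [cite: GreenbergVatsal2000, p. 2, (2)] -/
theorem isTorsion_and_mu_eq_zero_of_analyticMuLE_zero
    (hWu : thm16_charIdeal_dvd_multiplicative_of_reducible)
    (hpar : nonempty_modularParametrizationData) (hp2 : p ≠ 2)
    (hmult : W.HasMultiplicativeReductionAtPrime p) (hred : ¬ W.HasIrreducibleModPGaloisRep p)
    (hμ0 : AnalyticMuLE W p 0) {κ : ZpExtension ℚ p} {γ : Field.absoluteGaloisGroup ℚ}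
    (hκ : κ.IsCyclotomic) (hγ : κ.IsTopGenerator γ) (hγ' : IsCyclotomicVariable p γ)
    (D : W.SelmerDualData κ γ) : D.IsTorsion ∧ D.mu = 0 := by
  haveI : NeZero (W.conductorNorm ℤ) := ⟨(W.conductorNorm_pos_holds).ne'⟩
  haveI : Module.Finite (IwasawaAlgebra p) D.X := D.module_finite_holds hγ
  obtain ⟨Dm⟩ := hpar W
  have hf : IsNewformOf W Dm.f := Dm.isNewformOf
  obtain ⟨ϖ, -, hϖ, -⟩ := Dm.exists_rat_mul_realPeriodRat_eq_plusPeriod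
  obtain ⟨hX, hKns, hKs⟩ := hWu W p hp2 hmult hred hκ hγ hγ' hf D ϖ hϖ
  obtain ⟨fE, hfE⟩ := (charIdeal_isPrincipal_holds p D.X).principal
  have hchar : D.charIdeal = Ideal.span {fE} := hfE
  -- reading `μ(u · g) = 0` with `g = h · fE` on `fE`
  have read : ∀ (u g : IwasawaAlgebra p) (L : PowerSeries ℚ_[p]), u ≠ 0 → g ∈ D.charIdeal →
      (W.HasSplitMultiplicativeReductionAtPrime p → IsSplitMultPAdicLFunctionOf Dm.f p L) →
      (¬ W.HasSplitMultiplicativeReductionAtPrime p → IsMultPAdicLFunctionOf Dm.f p (-1) L) →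
      iwasawaToPowerSeries p (u * g) = PowerSeries.C ((ϖ : ℚ) : ℚ_[p]) * L → D.mu = 0 := by
    intro u g L hu0 hgmem hLs hLn hι
    have hgmem' : g ∈ Ideal.span {fE} := by rw [← hchar]; exact hgmem
    obtain ⟨h, hgh⟩ := Ideal.mem_span_singleton'.mp hgmem'
    obtain ⟨k', hk'⟩ := hμ0 Dm.f hf ϖ hϖ L hLs hLn
    have hL0 : PowerSeries.C ((ϖ : ℚ) : ℚ_[p]) * L ≠ 0 := ne_zero_of_lt_norm_coeff hk'
    have hG0 : u * g ≠ 0 := by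
      intro h0; apply hL0; rw [← hι, h0, map_zero]
    have hg0 : g ≠ 0 := fun h0 ↦ hG0 (by rw [h0, mul_zero])
    have hh0 : h ≠ 0 := fun h0 ↦ hg0 (by rw [← hgh, h0, zero_mul])
    have hfE0 : fE ≠ 0 := fun h0 ↦ hg0 (by rw [← hgh, h0, mul_zero])
    rw [← hι] at hk'
    have hμG : mu (u * g) = 0 := Nat.le_zero.mp (mu_le_of_lt_norm_coeff hk')
    have h1 : mu fE ≤ mu (u * g) := by
      rw [← hgh, ← mul_assoc]
      exact (mu_le_mu_mul hfE0 (mul_ne_zero hu0 hh0)).trans_eq (by rw [mul_comm])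
    rw [SelmerDualData.mu, ← mu_generator_eq_muInvariant D.X hX hfE0 hchar]
    omega
  refine ⟨hX, ?_⟩
  by_cases hsplit : W.HasSplitMultiplicativeReductionAtPrime p
  · obtain ⟨L, hL⟩ := exists_isSplitMultPAdicLFunctionOf hsplit hf
    obtain ⟨g, hgmem, hι⟩ := hKs hsplit L hL
    exact read PowerSeries.X g L PowerSeries.X_ne_zero hgmem (fun _ ↦ hL)
      (fun hns ↦ absurd hsplit hns) hι
  · obtain ⟨L, hL⟩ := exists_isMultPAdicLFunctionOf_neg_one_of_nonsplit hf hmult hsplit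
    obtain ⟨g, hgmem, hι⟩ := hKns hsplit L hL
    exact read 1 g L one_ne_zero hgmem (fun hs ↦ absurd hs hsplit) (fun _ ↦ hL)
      (by rw [one_mul]; exact hι)

/-- **ROUTE G at `p ‖ N` — the transfer.** Target: an X2 pair `(E₀, p)` (`p ≠ 2` multiplicative,
`E₀[p]` reducible) with `μ_an(E₀) = 0` (`AnalyticMuLE W p 0`; Wuthrich Thm. 16 `hWu`, modularity
`hpar`). Partner: ANY `W'` (a closed X1 or X2 pair) with `AlgebraicInvariantsEq W' p k'`. Congruence:
`E₀[p] ≅ E₀'[p]` (`TorsionIso W W' p`) and the typed Greenberg–Vatsal transfer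
`CongruentLambdaShift W W' p e` (at `p ‖ N` the integer `e` includes the trivial-zero term
`e_p(E₀') − e_p(E₀)`, see the file header). Then `AlgebraicInvariantsEq W p k` for the natural number
`k = k' + e`. [cite: GreenbergVatsal2000, §2 Prop. (2.8), Cor. (2.3), Prop. (2.4), Remark (2.10), pp. 14–15 and 26–27]
[cite: Wuthrich2014, Thm. 16 (p. 397)] -/
theorem algebraicInvariantsEq_of_congruentLambdaShift
    (hWu : thm16_charIdeal_dvd_multiplicative_of_reducible)
    (hpar : nonempty_modularParametrizationData) (hp2 : p ≠ 2)
    (hmult : W.HasMultiplicativeReductionAtPrime p) (hred : ¬ W.HasIrreducibleModPGaloisRep p)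
    (hμ0 : AnalyticMuLE W p 0) {k' : ℕ} (hinv' : AlgebraicInvariantsEq W' p k')
    (hiso : TorsionIso W W' p) {e : ℤ} (hG : CongruentLambdaShift W W' p e) {k : ℕ}
    (hk : (k : ℤ) = k' + e) : AlgebraicInvariantsEq W p k := by
  intro κ γ hκ hγ hγ' D
  haveI : Module.Finite (IwasawaAlgebra p) D.X := D.module_finite_holds hγ
  obtain ⟨D'⟩ := W'.nonempty_selmerDualData_holds κ γ hγ
  haveI : Module.Finite (IwasawaAlgebra p) D'.X := D'.module_finite_holds hγ
  obtain ⟨hX, hμ⟩ := isTorsion_and_mu_eq_zero_of_analyticMuLE_zero hWu hpar hp2 hmult hred hμ0 hκ hγ hγ' D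
  obtain ⟨hX', hμ', hl'⟩ := hinv' κ γ hκ hγ hγ' D'
  have key := hG hiso κ γ hκ hγ hγ' D D' hX hX' hμ hμ'
  rw [hl', ← hk] at key
  exact ⟨hX, hμ, by exact_mod_cast key⟩

/-- **ROUTE G with an X2 PARTNER for an X1 TARGET** (so that the good-ordinary leaf may use closed
multiplicative relatives): target `(E₀, p)` good ordinary Eisenstein, `p ≠ 2`, `μ_an(E₀) = 0`
(`X1.MuPart.AnalyticMuLE W p 0`; Wuthrich Thm. 16 `hW16`, modularity `hmod`); partner ANY `W'` with
`AlgebraicInvariantsEq W' p k'`; `TorsionIso W W' p`, `CongruentLambdaShift W W' p e`, `k = k' + e` ⇒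
`AlgebraicInvariantsEq W p k`. [cite: GreenbergVatsal2000, §2 Prop. (2.8), Cor. (2.3), Prop. (2.4), pp. 26–27]
[cite: Wuthrich2014, Thm. 16 (p. 397)] -/
theorem algebraicInvariantsEq_of_congruentLambdaShift_goodOrd
    (hW16 : Wuthrich2014.charIdeal_dvd_padicLFunction) (hmod : nonempty_modularParametrizationData)
    (hp : p ≠ 2) (hgood : W.HasGoodReductionAtPrime p) (hord : ¬ (p : ℤ) ∣ W.frobeniusTrace p)
    (hred : ¬ W.HasIrreducibleModPGaloisRep p) (hμ0 : X1.MuPart.AnalyticMuLE W p 0) {k' : ℕ}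
    (hinv' : AlgebraicInvariantsEq W' p k') (hiso : TorsionIso W W' p) {e : ℤ}
    (hG : CongruentLambdaShift W W' p e) {k : ℕ} (hk : (k : ℤ) = k' + e) :
    AlgebraicInvariantsEq W p k := by
  intro κ γ hκ hγ hγ' D
  haveI : NeZero (W.conductorNorm ℤ) := ⟨(W.conductorNorm_pos_holds).ne'⟩
  haveI : Module.Finite (IwasawaAlgebra p) D.X := D.module_finite_holds hγ
  obtain ⟨D'⟩ := W'.nonempty_selmerDualData_holds κ γ hγ
  haveI : Module.Finite (IwasawaAlgebra p) D'.X := D'.module_finite_holds hγ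
  obtain ⟨hX, -⟩ := isTorsion_and_exists_factorisation hW16 hmod hp hgood hord hred hκ hγ hγ' D
  have hμ : D.mu = 0 := mu_eq_zero_of_analyticMuLE_zero hW16 hmod hp hgood hord hred hμ0 hκ hγ hγ' D
  obtain ⟨hX', hμ', hl'⟩ := hinv' κ γ hκ hγ hγ' D'
  have key := hG hiso κ γ hκ hγ hγ' D D' hX hX' hμ hμ'
  rw [hl', ← hk] at key
  exact ⟨hX, hμ, by exact_mod_cast key⟩

end Target

end Summit.BirchSwinnertonDyer.Rank1Residual.X2

end
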